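import Summits.RiemannHypothesis.RiemannHypothesis.Theorems.NymanBeurlingNbRateLogNumeric
import HarnessLib

/-!
# Splittings / NB — the SHARP constant is RH-PLUS: `D(N) ≲ 2π(Σ_ρ 1/|ρ|²)/log N` forces SIMPLE zeros

Cell rh-split, seat rh-split-nb-neg g4 (card `SPLIT-nb-neg.md` §10; census rows V5 / V15 / V19 — the
conjunct (*) `d_N² ~ (2+γ−log 4π)/log N` of BDBLS 2000 / Landreau–Richard Conj. 1.4).
Family NB: `E_NB = (NbThesis ↔ RiemannHypothesis)`
(`Summit.RiemannHypothesis.RiemannHypothesis.Theorems.nbThesis_iff_riemannHypothesis`); integrand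
`I(N,a) = ∫⁻ ‖1 - ζ(1/2+it) Σ_{k<N} a_k (k+1)^{-(1/2+it)}‖² dt/(1/4+t²)` (`= 2π·dist²`) verbatim.

WHAT IS TYPED.  The printed asymptotic (*) enters every NB tail of §§2–9 of the card as the reason a
tail «should» hold (rate tails `C > 0.29`, doubling tails `θ > 1/2`).  Its UPPER half, in the weakest
(limsup) form and with the BDBLS constant `S₁ = Σ_ρ 1/|ρ|²` (distinct nontrivial zeros;
`Literature.Barriers.RiemannHypothesis.zeroSumInvNormSq`),

  `SharpRate :≡ ∀ ε > 0, ∀ᶠ N, ∃ a, I(N,a) ≤ (2π S₁ + ε)/log N`,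

is here shown to be of strength **RH ∧ «every nontrivial zero of ζ is simple»** (kernel, RH-free proof):

* `rh_of_eventually_nbRateBound` — any eventual rate bound `C/log N` gives RH alone (padding-free:
  `C/log N → 0` feeds `NbThesis`);
* `summable_multSq_of_eventually_nbRateBound`, `tsum_multSq_le_of_eventually_nbRateBound` — an
  eventually admissible `C` makes `Σ_ρ m_ρ²/|ρ|²` summable with `2π Σ ≤ C` (Burnol's Thm 1.3 in the
  tree's eventual form `two_pi_mul_sum_multSq_le_of_eventually_nbRateBound`);
* `two_pi_mul_zeroSum_add_excess_le` — **the multiple-zero surcharge**: for EVERY nontrivial zero `ρ₀`,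
  `2π (S₁ + (m_{ρ₀}² − 1)/|ρ₀|²) ≤ C`; one double zero at `ρ₀` lifts every admissible constant by
  `6π/|ρ₀|²` above the BDBLS value `2π S₁`;
* `rh_and_simple_of_sharpRate` — **`SharpRate → RiemannHypothesis ∧ ∀ ρ, m_ρ = 1`**;
* `rh_and_simple_of_sharpRate_le` / `rh_and_simple_of_sharpRate_numeric` — the same for any constant
  `A ≤ Σ_ρ m_ρ/|ρ|²`, in particular for the PRINTED constant `2+γ−log 4π` modulo Rosser's identity
  `Σ_ρ m_ρ/|ρ|² = 2+γ−log 4π` under RH (an explicit hypothesis; not in the tree);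
* `rh_and_simple_of_natural_sharpRate` — the same for the natural approximants
  `V_N = Σ μ(n)(1 − log n/log N) n^{-s}` (the conclusion of Bettin–Conrey–Farmer 2013 Thm 1, there
  derived from RH ∧ a `|ζ′(ρ)|⁻²`-moment hypothesis «which implicitly assumes the zeros simple», p. 3):
  the implicit assumption is FORCED by the conclusion.

SPLITTING READING (lens neg).  As a TAIL conjunct, (*) — even its limsup half — is not «RH in NB
clothes» but STRICTLY RH-PLUS in a named, typed sense: RH ∧ simplicity (∧ the rate).  It is
refutable by ONE multiple zero (a finite object, but none is known or expected), and its converse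
`RH → SharpRate` is open (BCF's open question).  So in `FIN ∧ (*)`-shaped splittings FIN is decoration
(tail alone ⟹ RH, tree) AND the tail over-shoots RH by simplicity: costume-plus, not a splitting.

No definitions; RH-free proofs; std axioms expected.  References: Burnol, arXiv:math/0103058 = Adv.
Math. 170 (2002), Thms 1.2–1.3 [corpus:paper:arxiv-math_0103058 p.2]; Landreau–Richard, Exp. Math. 11
(2002) 349–360, Thm 1.2, Conj. 1.4 [corpus:paper:landreau2002 p.2–3]; Bettin–Conrey–Farmer, arXiv:1211.5191
p.3 [corpus:paper:arxiv-1211.5191 p.3].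

HONEST LABEL: «SPLITTING SEARCH over kernel-typed RH-EQUIVALENCES; a splitting A ∧ B ⟹ RH is
CONDITIONAL bookkeeping unless A and B are both proved; nothing here bears on the truth of RH.»
-/

noncomputable section

-- D-0017: `Summit.<S>.<S>.…` is the designed namespace of a single-problem summit.
set_option linter.dupNamespace false

open Complex MeasureTheory Set Filter Topology
open scoped Real ENNReal

namespace Summit.RiemannHypothesis.RiemannHypothesis.Theorems.Splittings.NbSharpConstant

open Summit.RiemannHypothesis.RiemannHypothesis.Theses.NymanBeurling
open Summit.RiemannHypothesis.RiemannHypothesis.Theorems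
open Literature.NumberTheory.LFunctions Literature.Barriers.RiemannHypothesis

/-! ## 1. Any eventual rate bound gives RH -/

/-- nb/neg g4: if eventually in `N` some length-`N` Dirichlet polynomial achieves
`I(N,a) ≤ C/log N`, then RH (`C/log N → 0` feeds `NbThesis`; no padding, no verified zeros).
[cite: BaezDuarte2003, Thm. 1.1] -/
theorem rh_of_eventually_nbRateBound {C : ℝ}
    (hC : ∀ᶠ N : ℕ in atTop, ∃ a : Fin N → ℂ, ∫⁻ t : ℝ, ENNReal.ofReal (‖1 - riemannZeta (1 / 2 + t * Complex.I) *
        ∑ n : Fin N, a n * ((n : ℂ) + 1) ^ (-(1 / 2 + t * Complex.I))‖ ^ 2 / (1 / 4 + t ^ 2)) ≤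
      ENNReal.ofReal (C / Real.log N)) :
    _root_.RiemannHypothesis := by
  refine nbThesis_iff_riemannHypothesis.mp fun ε hε ↦ ?_
  have ht : Tendsto (fun N : ℕ ↦ C / Real.log N) atTop (𝓝 0) :=
    tendsto_const_nhds.div_atTop (Real.tendsto_log_atTop.comp tendsto_natCast_atTop_atTop)
  obtain ⟨N, hNε, a, ha⟩ := ((ht.eventually (gt_mem_nhds hε)).and hC).exists
  exact ⟨N, a, ha.trans_lt ((ENNReal.ofReal_lt_ofReal_iff hε).2 hNε)⟩

/-! ## 2. An eventually admissible constant makes `Σ m_ρ²/|ρ|²` summable, `2π Σ ≤ C` -/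

/-- Every nontrivial zero has multiplicity `m_ρ ≥ 1` (as a real number). [folklore] -/
theorem one_le_zeroOrder_of_mem {ρ : ℂ} (hρ : ρ ∈ ZetaZeros.riemannZetaNontrivialZeros) :
    (1 : ℝ) ≤ riemannZetaZeroOrder ρ := by
  obtain ⟨hz, -, h1⟩ := mem_riemannZetaNontrivialZeros_iff_holds.1 hρ
  have hne : ρ ≠ 1 := fun e ↦ by rw [e, Complex.one_re] at h1; exact lt_irrefl _ h1
  have h := (riemannZetaZeroOrder_pos_iff hne).2 hz
  have h' : (1 : ℤ) ≤ riemannZetaZeroOrder ρ := h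
  exact_mod_cast h'

/-- A nontrivial zero is not `0`. [folklore] -/
theorem norm_pos_of_mem {ρ : ℂ} (hρ : ρ ∈ ZetaZeros.riemannZetaNontrivialZeros) : 0 < ‖ρ‖ := by
  obtain ⟨-, h0, -⟩ := mem_riemannZetaNontrivialZeros_iff_holds.1 hρ
  exact norm_pos_iff.2 fun e ↦ by rw [e, Complex.zero_re] at h0; exact lt_irrefl _ h0

/-- Termwise comparison `1/|ρ|² ≤ m_ρ²/|ρ|²` on the nontrivial zeros. [folklore] -/
theorem inv_normSq_le_multSq_div (ρ : ZetaZeros.riemannZetaNontrivialZeros) :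
    1 / ‖(ρ : ℂ)‖ ^ 2 ≤ (riemannZetaZeroOrder (ρ : ℂ) : ℝ) ^ 2 / ‖(ρ : ℂ)‖ ^ 2 :=
  div_le_div_of_nonneg_right (by nlinarith [one_le_zeroOrder_of_mem ρ.2]) (sq_nonneg _)

/-- nb/neg g4: under an EVENTUALLY admissible constant `C`, every finite family of nontrivial zeros
has `Σ m_ρ²/|ρ|² ≤ C/(2π)` (RH from §1 puts the zeros on the line; then Burnol's finite-family bound
in eventual form). [cite: Burnol2002, Thm. 1.3] -/
theorem sum_multSq_le_of_eventually_nbRateBound {C : ℝ}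
    (hC : ∀ᶠ N : ℕ in atTop, ∃ a : Fin N → ℂ, ∫⁻ t : ℝ, ENNReal.ofReal (‖1 - riemannZeta (1 / 2 + t * Complex.I) *
        ∑ n : Fin N, a n * ((n : ℂ) + 1) ^ (-(1 / 2 + t * Complex.I))‖ ^ 2 / (1 / 4 + t ^ 2)) ≤
      ENNReal.ofReal (C / Real.log N))
    (T : Finset ZetaZeros.riemannZetaNontrivialZeros) :
    ∑ ρ ∈ T, (riemannZetaZeroOrder (ρ : ℂ) : ℝ) ^ 2 / ‖(ρ : ℂ)‖ ^ 2 ≤ C / (2 * π) := by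
  classical
  have hRH : _root_.RiemannHypothesis := rh_of_eventually_nbRateBound hC
  have hT' : ∀ ρ ∈ T.image Subtype.val, riemannZeta ρ = 0 ∧ ρ.re = 1 / 2 := by
    intro ρ hρ
    obtain ⟨x, -, rfl⟩ := Finset.mem_image.1 hρ
    exact nontrivialZero_on_line hRH x.2
  have key := two_pi_mul_sum_multSq_le_of_eventually_nbRateBound hC _ hT'
  rw [Finset.sum_image fun x _ y _ hxy ↦ Subtype.ext hxy] at key
  rw [le_div_iff₀ (by positivity)]
  linarith

/-- nb/neg g4: an eventually admissible constant makes `ρ ↦ m_ρ²/|ρ|²` summable over the distinct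
nontrivial zeros. [cite: Burnol2002, Thm. 1.3] -/
theorem summable_multSq_of_eventually_nbRateBound {C : ℝ}
    (hC : ∀ᶠ N : ℕ in atTop, ∃ a : Fin N → ℂ, ∫⁻ t : ℝ, ENNReal.ofReal (‖1 - riemannZeta (1 / 2 + t * Complex.I) *
        ∑ n : Fin N, a n * ((n : ℂ) + 1) ^ (-(1 / 2 + t * Complex.I))‖ ^ 2 / (1 / 4 + t ^ 2)) ≤
      ENNReal.ofReal (C / Real.log N)) :
    Summable fun ρ : ZetaZeros.riemannZetaNontrivialZeros ↦
      (riemannZetaZeroOrder (ρ : ℂ) : ℝ) ^ 2 / ‖(ρ : ℂ)‖ ^ 2 :=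
  summable_of_sum_le (fun ρ ↦ by positivity) (sum_multSq_le_of_eventually_nbRateBound hC)

/-- nb/neg g4: … and `ρ ↦ 1/|ρ|²` summable too (termwise domination, `m_ρ ≥ 1`). [folklore] -/
theorem summable_invNormSq_of_eventually_nbRateBound {C : ℝ}
    (hC : ∀ᶠ N : ℕ in atTop, ∃ a : Fin N → ℂ, ∫⁻ t : ℝ, ENNReal.ofReal (‖1 - riemannZeta (1 / 2 + t * Complex.I) *
        ∑ n : Fin N, a n * ((n : ℂ) + 1) ^ (-(1 / 2 + t * Complex.I))‖ ^ 2 / (1 / 4 + t ^ 2)) ≤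
      ENNReal.ofReal (C / Real.log N)) :
    Summable fun ρ : ZetaZeros.riemannZetaNontrivialZeros ↦ 1 / ‖(ρ : ℂ)‖ ^ 2 :=
  Summable.of_nonneg_of_le (fun ρ ↦ by positivity) inv_normSq_le_multSq_div
    (summable_multSq_of_eventually_nbRateBound hC)

/-- nb/neg g4: `2π Σ_ρ m_ρ²/|ρ|² ≤ C` as a convergent sum (`tsum` = Burnol's constant
`zeroSumMultSqInvNormSq`) for every eventually admissible `C`. [cite: Burnol2002, Thm. 1.3] -/
theorem tsum_multSq_le_of_eventually_nbRateBound {C : ℝ}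
    (hC : ∀ᶠ N : ℕ in atTop, ∃ a : Fin N → ℂ, ∫⁻ t : ℝ, ENNReal.ofReal (‖1 - riemannZeta (1 / 2 + t * Complex.I) *
        ∑ n : Fin N, a n * ((n : ℂ) + 1) ^ (-(1 / 2 + t * Complex.I))‖ ^ 2 / (1 / 4 + t ^ 2)) ≤
      ENNReal.ofReal (C / Real.log N)) :
    2 * π * zeroSumMultSqInvNormSq ≤ C := by
  have h := (summable_multSq_of_eventually_nbRateBound hC).tsum_le_of_sum_le
    (sum_multSq_le_of_eventually_nbRateBound hC)
  unfold zeroSumMultSqInvNormSq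
  rw [le_div_iff₀ (by positivity)] at h
  linarith

/-! ## 3. The multiple-zero surcharge -/

/-- nb/neg g4 — **multiple-zero surcharge.** If `C` is eventually admissible then for EVERY nontrivial
zero `ρ₀`, `2π (Σ_ρ 1/|ρ|² + (m_{ρ₀}² − 1)/|ρ₀|²) ≤ C`: replacing the term `1/|ρ₀|²` of the BDBLS sum by
Burnol's `m_{ρ₀}²/|ρ₀|²` still stays below `C/2π` (`Function.update` of the summable family, `HasSum.update`,
termwise `≤ m_ρ²/|ρ|²`).  A double zero at `ρ₀` lifts every admissible constant by `6π/|ρ₀|²`.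
[cite: Burnol2002, Thms. 1.2–1.3] -/
theorem two_pi_mul_zeroSum_add_excess_le {C : ℝ}
    (hC : ∀ᶠ N : ℕ in atTop, ∃ a : Fin N → ℂ, ∫⁻ t : ℝ, ENNReal.ofReal (‖1 - riemannZeta (1 / 2 + t * Complex.I) *
        ∑ n : Fin N, a n * ((n : ℂ) + 1) ^ (-(1 / 2 + t * Complex.I))‖ ^ 2 / (1 / 4 + t ^ 2)) ≤
      ENNReal.ofReal (C / Real.log N))
    {ρ₀ : ℂ} (hρ₀ : ρ₀ ∈ ZetaZeros.riemannZetaNontrivialZeros) :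
    2 * π * (zeroSumInvNormSq + ((riemannZetaZeroOrder ρ₀ : ℝ) ^ 2 - 1) / ‖ρ₀‖ ^ 2) ≤ C := by
  classical
  set g : ZetaZeros.riemannZetaNontrivialZeros → ℝ :=
    fun ρ ↦ (riemannZetaZeroOrder (ρ : ℂ) : ℝ) ^ 2 / ‖(ρ : ℂ)‖ ^ 2 with hg
  set f : ZetaZeros.riemannZetaNontrivialZeros → ℝ := fun ρ ↦ 1 / ‖(ρ : ℂ)‖ ^ 2 with hf
  have hgs : Summable g := summable_multSq_of_eventually_nbRateBound hC
  have hfs : Summable f := summable_invNormSq_of_eventually_nbRateBound hC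
  have hgle : ∑' ρ, g ρ ≤ C / (2 * π) :=
    hgs.tsum_le_of_sum_le (sum_multSq_le_of_eventually_nbRateBound hC)
  -- the updated family `k = f` except `k ρ₀ = g ρ₀`
  let z : ZetaZeros.riemannZetaNontrivialZeros := ⟨ρ₀, hρ₀⟩
  have hk : HasSum (Function.update f z (g z)) (g z - f z + ∑' ρ, f ρ) := hfs.hasSum.update z (g z)
  have hkg : ∀ ρ, Function.update f z (g z) ρ ≤ g ρ := by
    intro ρ
    rcases eq_or_ne ρ z with rfl | hne
    · rw [Function.update_self]
    · rw [Function.update_of_ne hne]; exact inv_normSq_le_multSq_div ρ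
  have hle : g z - f z + ∑' ρ, f ρ ≤ ∑' ρ, g ρ := hasSum_le hkg hk hgs.hasSum
  have hS : zeroSumInvNormSq = ∑' ρ, f ρ := rfl
  have hz : g z - f z = ((riemannZetaZeroOrder ρ₀ : ℝ) ^ 2 - 1) / ‖ρ₀‖ ^ 2 := by
    simp only [hg, hf, z]; ring
  rw [hS, ← hz, mul_comm, ← le_div_iff₀ (by positivity : (0 : ℝ) < 2 * π)]
  linarith

/-! ## 4. The sharp constant forces RH and simple zeros -/

/-- nb/neg g4 — **the sharp rate is RH ∧ SIMPLE.** If for every `ε > 0`, eventually in `N`, some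
length-`N` Dirichlet polynomial achieves `I(N,a) ≤ (2π Σ_ρ 1/|ρ|² + ε)/log N` (the limsup half of the
BDBLS / Landreau–Richard asymptotic `d_N² ~ (2+γ−log 4π)/log N`, with the constant in its zero-sum form),
then RH holds AND every nontrivial zero of `ζ` is simple (`m_ρ = 1`): by §3 each `ρ₀` would otherwise
cost `2π(m_{ρ₀}² − 1)/|ρ₀|² > ε`. [cite: Burnol2002, Thms. 1.2–1.3] [cite: BettinConreyFarmer2013, §1] -/
theorem rh_and_simple_of_sharpRate
    (h : ∀ ε : ℝ, 0 < ε → ∀ᶠ N : ℕ in atTop, ∃ a : Fin N → ℂ, ∫⁻ t : ℝ, ENNReal.ofReal (‖1 - riemannZeta (1 / 2 + t * Complex.I) *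
        ∑ n : Fin N, a n * ((n : ℂ) + 1) ^ (-(1 / 2 + t * Complex.I))‖ ^ 2 / (1 / 4 + t ^ 2)) ≤
      ENNReal.ofReal ((2 * π * zeroSumInvNormSq + ε) / Real.log N)) :
    _root_.RiemannHypothesis ∧
      ∀ ρ ∈ ZetaZeros.riemannZetaNontrivialZeros, riemannZetaZeroOrder ρ = 1 := by
  refine ⟨rh_of_eventually_nbRateBound (h 1 one_pos), fun ρ hρ ↦ ?_⟩
  have hρ0 : 0 < ‖ρ‖ := norm_pos_of_mem hρ
  have hm1 : (1 : ℝ) ≤ riemannZetaZeroOrder ρ := one_le_zeroOrder_of_mem hρ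
  -- the excess `(m² - 1)/|ρ|²` is `≤ ε/2π` for every `ε > 0`, hence `≤ 0`
  have hex : ((riemannZetaZeroOrder ρ : ℝ) ^ 2 - 1) / ‖ρ‖ ^ 2 ≤ 0 := by
    have key : ∀ ε : ℝ, 0 < ε →
        ((riemannZetaZeroOrder ρ : ℝ) ^ 2 - 1) / ‖ρ‖ ^ 2 ≤ 0 + ε := by
      intro ε hε
      have h1 := two_pi_mul_zeroSum_add_excess_le (h (2 * π * ε) (by positivity)) hρ
      nlinarith [Real.pi_pos, h1]
    exact le_of_forall_pos_le_add key
  have hsq : (riemannZetaZeroOrder ρ : ℝ) ^ 2 ≤ 1 := by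
    have := (div_le_iff₀ (by positivity : (0 : ℝ) < ‖ρ‖ ^ 2)).1 hex
    linarith
  have hle1 : (riemannZetaZeroOrder ρ : ℝ) ≤ 1 := by nlinarith
  have heq : (riemannZetaZeroOrder ρ : ℝ) = 1 := le_antisymm hle1 hm1
  exact_mod_cast heq

/-- nb/neg g4: under `SharpRate`, Burnol's constant equals the BDBLS constant:
`Σ_ρ m_ρ²/|ρ|² = Σ_ρ 1/|ρ|²`. [cite: Burnol2002, Thms. 1.2–1.3] -/
theorem zeroSumMultSq_eq_zeroSum_of_sharpRate
    (h : ∀ ε : ℝ, 0 < ε → ∀ᶠ N : ℕ in atTop, ∃ a : Fin N → ℂ, ∫⁻ t : ℝ, ENNReal.ofReal (‖1 - riemannZeta (1 / 2 + t * Complex.I) *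
        ∑ n : Fin N, a n * ((n : ℂ) + 1) ^ (-(1 / 2 + t * Complex.I))‖ ^ 2 / (1 / 4 + t ^ 2)) ≤
      ENNReal.ofReal ((2 * π * zeroSumInvNormSq + ε) / Real.log N)) :
    zeroSumMultSqInvNormSq = zeroSumInvNormSq := by
  obtain ⟨-, hs⟩ := rh_and_simple_of_sharpRate h
  unfold zeroSumMultSqInvNormSq zeroSumInvNormSq
  refine tsum_congr fun ρ ↦ ?_
  rw [hs ρ ρ.2]
  push_cast
  ring

/-! ## 5. The natural approximants (Bettin–Conrey–Farmer's asymptotic) -/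

/-- nb/neg g4: if the NATURAL approximants `V_N(s) = Σ_{n≤N} μ(n)(1 − log n/log N) n^{-s}` satisfy
`I(V_N) ≤ (2π Σ_ρ 1/|ρ|² + ε)/log N` eventually, for every `ε > 0` — the conclusion of
Bettin–Conrey–Farmer 2013, Thm 1, there obtained from RH and a `|ζ′(ρ)|⁻²`-moment bound «which
implicitly assumes that the zeros are all simple» (p. 3) — then RH holds and all nontrivial zeros ARE
simple: the implicit assumption is forced by the conclusion. [cite: BettinConreyFarmer2013, Thm. 1] -/
theorem rh_and_simple_of_natural_sharpRate
    (h : ∀ ε : ℝ, 0 < ε → ∀ᶠ N : ℕ in atTop, ∫⁻ t : ℝ, ENNReal.ofReal (‖1 - riemannZeta (1 / 2 + t * Complex.I) *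
        ∑ n : Fin N, ((ArithmeticFunction.moebius (n + 1) : ℝ) *
          (1 - Real.log ((n : ℝ) + 1) / Real.log N) : ℂ) * ((n : ℂ) + 1) ^ (-(1 / 2 + t * Complex.I))‖ ^ 2 /
            (1 / 4 + t ^ 2)) ≤
      ENNReal.ofReal ((2 * π * zeroSumInvNormSq + ε) / Real.log N)) :
    _root_.RiemannHypothesis ∧
      ∀ ρ ∈ ZetaZeros.riemannZetaNontrivialZeros, riemannZetaZeroOrder ρ = 1 :=
  rh_and_simple_of_sharpRate fun ε hε ↦ (h ε hε).mono fun _ hN ↦ ⟨_, hN⟩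

/-! ## 6. General constants `A ≤ Σ_ρ m_ρ/|ρ|²`; the printed constant `2+γ−log 4π` modulo Rosser's identity -/

/-- nb/neg g4 — **general form.** If the eventual rate holds with every constant `> 2πA` and
`A ≤ Σ_ρ m_ρ/|ρ|²` (tsum over the distinct nontrivial zeros), then RH holds and every nontrivial zero is
simple: `Σ m_ρ²/|ρ|² ≤ A ≤ Σ m_ρ/|ρ|² ≤ Σ m_ρ²/|ρ|²` forces `m_ρ² = m_ρ` termwise.
[cite: Burnol2002, Thm. 1.3] -/
theorem rh_and_simple_of_sharpRate_le {A : ℝ}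
    (hA : A ≤ ∑' ρ : ZetaZeros.riemannZetaNontrivialZeros,
      (riemannZetaZeroOrder (ρ : ℂ) : ℝ) / ‖(ρ : ℂ)‖ ^ 2)
    (h : ∀ ε : ℝ, 0 < ε → ∀ᶠ N : ℕ in atTop, ∃ a : Fin N → ℂ, ∫⁻ t : ℝ, ENNReal.ofReal (‖1 - riemannZeta (1 / 2 + t * Complex.I) *
        ∑ n : Fin N, a n * ((n : ℂ) + 1) ^ (-(1 / 2 + t * Complex.I))‖ ^ 2 / (1 / 4 + t ^ 2)) ≤
      ENNReal.ofReal ((2 * π * A + ε) / Real.log N)) :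
    _root_.RiemannHypothesis ∧
      ∀ ρ ∈ ZetaZeros.riemannZetaNontrivialZeros, riemannZetaZeroOrder ρ = 1 := by
  classical
  refine ⟨rh_of_eventually_nbRateBound (h 1 one_pos), ?_⟩
  set g : ZetaZeros.riemannZetaNontrivialZeros → ℝ :=
    fun ρ ↦ (riemannZetaZeroOrder (ρ : ℂ) : ℝ) ^ 2 / ‖(ρ : ℂ)‖ ^ 2 with hg
  set k : ZetaZeros.riemannZetaNontrivialZeros → ℝ :=
    fun ρ ↦ (riemannZetaZeroOrder (ρ : ℂ) : ℝ) / ‖(ρ : ℂ)‖ ^ 2 with hk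
  have hgs : Summable g := summable_multSq_of_eventually_nbRateBound (h 1 one_pos)
  -- `Σ' m²/|ρ|² ≤ A`
  have hgA : ∑' ρ, g ρ ≤ A := by
    refine le_of_forall_pos_le_add fun ε hε ↦ ?_
    have h1 := (summable_multSq_of_eventually_nbRateBound (h (2 * π * ε) (by positivity))).tsum_le_of_sum_le
      (sum_multSq_le_of_eventually_nbRateBound (h (2 * π * ε) (by positivity)))
    calc ∑' ρ, g ρ ≤ (2 * π * A + 2 * π * ε) / (2 * π) := h1
      _ = A + ε := by field_simp
  -- termwise `m/|ρ|² ≤ m²/|ρ|²`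
  have hm : ∀ ρ : ZetaZeros.riemannZetaNontrivialZeros, (1 : ℝ) ≤ riemannZetaZeroOrder (ρ : ℂ) :=
    fun ρ ↦ one_le_zeroOrder_of_mem ρ.2
  have hkg : ∀ ρ, k ρ ≤ g ρ := fun ρ ↦ by
    simp only [hk, hg]
    exact div_le_div_of_nonneg_right (by nlinarith [hm ρ]) (sq_nonneg _)
  have hk0 : ∀ ρ, 0 ≤ k ρ := fun ρ ↦ by
    simp only [hk]
    exact div_nonneg (by linarith [hm ρ]) (sq_nonneg _)
  have hks : Summable k := Summable.of_nonneg_of_le hk0 hkg hgs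
  have hkle : ∑' ρ, k ρ ≤ ∑' ρ, g ρ := hks.tsum_le_tsum hkg hgs
  have heq : ∑' ρ, g ρ = ∑' ρ, k ρ := le_antisymm (hgA.trans hA) hkle
  have h0 : HasSum (fun ρ ↦ g ρ - k ρ) 0 := by
    have := hgs.hasSum.sub hks.hasSum
    rwa [heq, sub_self] at this
  have hzero := (hasSum_zero_iff_of_nonneg (fun ρ ↦ sub_nonneg.2 (hkg ρ))).1 h0
  intro ρ hρ
  have e := congrFun hzero ⟨ρ, hρ⟩
  simp only [hg, hk, Pi.zero_apply, sub_eq_zero] at e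
  -- `e : m²/|ρ|² = m/|ρ|²`
  have hn : (‖ρ‖ ^ 2 : ℝ) ≠ 0 := by
    have := norm_pos_of_mem hρ
    positivity
  rw [div_left_inj' hn] at e
  have hm1 := hm ⟨ρ, hρ⟩
  have heq1 : (riemannZetaZeroOrder ρ : ℝ) = 1 := by nlinarith
  exact_mod_cast heq1

/-- nb/neg g4 — **the printed constant.** Landreau–Richard's Conjecture 1.4 / BDBLS, in limsup form with the
NUMERIC constant: `∀ ε > 0, ∀ᶠ N, ∃ a, I(N,a) ≤ (2π(2+γ−log 4π) + ε)/log N`, forces RH and simple zeros —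
modulo ROSSER'S IDENTITY `Σ_ρ m_ρ/|ρ|² = 2 + γ − log 4π` under RH (Rosser 1939 p. 29, as quoted by
Landreau–Richard 2002 p. 2; classical from `Σ_ρ 1/ρ = 1 + γ/2 − ½ log 4π`, NOT in the tree — taken here
as the explicit hypothesis `hRosser`, so the statement is RH-free and identity-conditional).
[cite: LandreauRichard2002, Thm. 1.3 and Conj. 1.4] -/
theorem rh_and_simple_of_sharpRate_numeric
    (hRosser : _root_.RiemannHypothesis →
      ∑' ρ : ZetaZeros.riemannZetaNontrivialZeros, (riemannZetaZeroOrder (ρ : ℂ) : ℝ) / ‖(ρ : ℂ)‖ ^ 2 =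
        2 + Real.eulerMascheroniConstant - Real.log (4 * π))
    (h : ∀ ε : ℝ, 0 < ε → ∀ᶠ N : ℕ in atTop, ∃ a : Fin N → ℂ, ∫⁻ t : ℝ, ENNReal.ofReal (‖1 - riemannZeta (1 / 2 + t * Complex.I) *
        ∑ n : Fin N, a n * ((n : ℂ) + 1) ^ (-(1 / 2 + t * Complex.I))‖ ^ 2 / (1 / 4 + t ^ 2)) ≤
      ENNReal.ofReal ((2 * π * (2 + Real.eulerMascheroniConstant - Real.log (4 * π)) + ε) / Real.log N)) :
    _root_.RiemannHypothesis ∧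
      ∀ ρ ∈ ZetaZeros.riemannZetaNontrivialZeros, riemannZetaZeroOrder ρ = 1 :=
  rh_and_simple_of_sharpRate_le (hRosser (rh_of_eventually_nbRateBound (h 1 one_pos))).symm.le h

end Summit.RiemannHypothesis.RiemannHypothesis.Theorems.Splittings.NbSharpConstant

end
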